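import Literature.Geometry.Riemannian.LinearHeatWeakRegularity
import Literature.Geometry.Riemannian.SpaceTimeKernelIntegral
import Literature.Geometry.Riemannian.LinearHeatVeryWeakClassical
import Mathlib.Analysis.Normed.Operator.Banach
import Mathlib.MeasureTheory.Function.ConvergenceInMeasure
import Mathlib.Topology.ContinuousMap.Compact
import HarnessLib

/-!
# A uniform interior sup bound for very weak solutions of the linear heat equation of a family
# of metrics (hypoellipticity + closed graph theorem)

`exists_contMDiffOn_ae_eq_of_linearHeat_veryWeak` (`LinearHeatWeakRegularity.lean`, Hörmander 1967)
says that a locally integrable very weak solution `u` of `∂ₛu = Δ_{h(s)}u − Qu` on `M × T` agrees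
a.e. with a `C^∞` function `ũ`. This file adds the QUANTITATIVE companion that the qualitative
statement yields for free through the closed graph theorem: on a compact sub-slab the smooth
representative is bounded by the `L¹` norm of `u`, with a constant independent of `u`,

  `sup_{M × [a', b']} |ũ| ≤ C ∫_{M × (a, b)} |u|`    (`a < a' < b' < b`)

(`exists_const_sup_le_integral_of_linearHeat_veryWeak`). Proof: the very weak solutions form a
closed subspace `S` of `L¹(M × (a, b))`; `u ↦ ũ|_{M × [a',b']}` is a well-defined linear map
`S → C(M × [a', b'])` (continuous representatives on the open slab are unique) with sequentially
closed graph (`L¹` convergence gives an a.e. convergent subsequence); closed graph theorem.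
Purpose: bounds uniform in the base point for the conjugate heat kernel `K(x,t;·,·)` of a Ricci
flow (each is such a solution of `L¹` norm `b − a`). Everything is proved; no named facts.

## References

* L. Hörmander, *Hypoelliptic second order differential equations*, Acta Math. 119 (1967),
  Thm. 1.1. [Hormander1967] — and Banach's closed graph theorem (Mathlib).
-/

noncomputable section

open Bundle Set Function Filter Manifold MeasureTheory Measure TopologicalSpace
open scoped Manifold ContDiff Topology ENNReal NNReal

namespace Literature.Geometry.Riemannian

open Lorentzian Lorentzian.PseudoRiemannianMetric

section UniformBound

variable {m : ℕ} {H : Type*} [TopologicalSpace H]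
  {I : ModelWithCorners ℝ (EuclideanSpace ℝ (Fin m)) H} [I.Boundaryless]
  {M : Type*} [TopologicalSpace M] [ChartedSpace H M] [IsManifold I ∞ M]
  [T2Space M] [CompactSpace M] [SecondCountableTopology M] [MeasurableSpace M] [BorelSpace M]
  {h : ℝ → PseudoRiemannianMetric I ∞ (EuclideanSpace ℝ (Fin m)) (TangentSpace I : M → Type _)}
  {g₀ : PseudoRiemannianMetric I ∞ (EuclideanSpace ℝ (Fin m)) (TangentSpace I : M → Type _)}

omit [I.Boundaryless] [IsManifold I ∞ M] [T2Space M] [CompactSpace M] [SecondCountableTopology M]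
  [BorelSpace M] [ChartedSpace H M] in
/-- **Continuous representatives on an open set are unique** (the measure charging open sets):
two functions continuous on the open `O` which agree a.e. on `O` agree on `O`. [folklore] -/
theorem eqOn_of_ae_eq_of_continuousOn {μ : Measure (M × ℝ)} [μ.IsOpenPosMeasure] {O : Set (M × ℝ)}
    (hO : IsOpen O) {v w : M × ℝ → ℝ} (hv : ContinuousOn v O) (hw : ContinuousOn w O)
    (h : ∀ᵐ p ∂μ, p ∈ O → v p = w p) : EqOn v w O := by
  intro p hp
  have h1 := nonneg_of_ae_of_continuousOn (μ := μ) hO (hw.sub hv)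
    (h.mono fun q hq hqO ↦ by rw [Pi.sub_apply, hq hqO, sub_self]) p hp
  have h2 := nonneg_of_ae_of_continuousOn (μ := μ) hO (hv.sub hw)
    (h.mono fun q hq hqO ↦ by rw [Pi.sub_apply, hq hqO, sub_self]) p hp
  exact le_antisymm (by simpa using h1) (by simpa using h2)

omit [I.Boundaryless] [T2Space M] [CompactSpace M] [SecondCountableTopology M] [MeasurableSpace M]
  [BorelSpace M] in
/-- The derivatives of a smooth function on `M × ℝ` — the time derivative and the Laplacians of
the time slices for any family of metrics — vanish outside its closed support. [folklore] -/
theorem deriv_eq_zero_and_laplaceBeltrami_eq_zero_of_notMem_tsupport {ζ : M × ℝ → ℝ}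
    (g : PseudoRiemannianMetric I ∞ (EuclideanSpace ℝ (Fin m)) (TangentSpace I : M → Type _))
    {y : M} {σ : ℝ} (hp : (y, σ) ∉ tsupport ζ) :
    deriv (fun s ↦ ζ (y, s)) σ = 0 ∧ g.laplaceBeltrami (fun y' ↦ ζ (y', σ)) y = 0 := by
  have hev : ζ =ᶠ[𝓝 (y, σ)] 0 := notMem_tsupport_iff_eventuallyEq.1 hp
  constructor
  · have h1 : (fun s ↦ ζ (y, s)) =ᶠ[𝓝 σ] 0 :=
      eventuallyEq_zero_comp_of_eventuallyEq_zero (ι := fun s ↦ (y, s))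
        (Continuous.prodMk_right y) hev
    rw [h1.deriv_eq]
    exact deriv_const σ 0
  · exact laplaceBeltrami_eq_zero_of_eventuallyEq_zero g
      (eventuallyEq_zero_comp_of_eventuallyEq_zero (ι := fun y' ↦ (y', σ))
        (Continuous.prodMk_left σ) hev)

omit [I.Boundaryless] [IsManifold I ∞ M] [T2Space M] [CompactSpace M] [SecondCountableTopology M]
  [BorelSpace M] [ChartedSpace H M] [MeasurableSpace M] in
/-- A subset of the closed slab `M × [a', b']` which is relatively open and nonempty meets the
open slab `M × (a', b')` in a nonempty open set (`a' < b'`). [folklore] -/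
theorem exists_mem_Ioo_of_relOpen {a' b' : ℝ} (ha'b' : a' < b') {U : Set (M × ℝ)} (hU : IsOpen U)
    {p : M × ℝ} (hpU : p ∈ U) (hp : p ∈ (univ : Set M) ×ˢ Icc a' b') :
    ∃ q ∈ U, q ∈ (univ : Set M) ×ˢ Ioo a' b' := by
  obtain ⟨y, τ⟩ := p
  have hτ : τ ∈ Icc a' b' := hp.2
  -- a product neighbourhood of `(y, τ)` inside `U`
  obtain ⟨V, W, hV, hW, hyV, hτW, hVW⟩ := isOpen_prod_iff.1 hU y τ hpU
  obtain ⟨δ, hδ, hδW⟩ := Metric.isOpen_iff.1 hW τ hτW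
  -- a time `τ'` within `δ` of `τ` and strictly inside `(a', b')`: move a little towards the centre
  obtain ⟨τ', hτ'δ, hτ'⟩ : ∃ τ', |τ' - τ| < δ ∧ τ' ∈ Ioo a' b' := by
    set c : ℝ := (a' + b') / 2 with hc
    set t : ℝ := min 1 (δ / 2 / (|c - τ| + 1))
    have ht0 : 0 < t := lt_min one_pos (by positivity)
    have ht1 : t ≤ 1 := min_le_left _ _
    refine ⟨τ + t * (c - τ), ?_, by show a' < τ + t * (c - τ); nlinarith [hτ.1, hτ.2],
      by show τ + t * (c - τ) < b'; nlinarith [hτ.1, hτ.2]⟩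
    rw [show |τ + t * (c - τ) - τ| = t * |c - τ| by
      rw [add_sub_cancel_left, abs_mul, abs_of_pos ht0]]
    have h2 : t * |c - τ| ≤ δ / 2 / (|c - τ| + 1) * |c - τ| :=
      mul_le_mul_of_nonneg_right (min_le_right _ _) (abs_nonneg _)
    have h3 : δ / 2 / (|c - τ| + 1) * |c - τ| ≤ δ / 2 := by
      rw [div_mul_eq_mul_div, div_le_iff₀ (by positivity)]
      nlinarith [abs_nonneg (c - τ)]
    linarith
  refine ⟨(y, τ'), hVW ⟨hyV, hδW ?_⟩, mem_univ _, hτ'⟩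
  rwa [Metric.mem_ball, Real.dist_eq]

/-- **Uniform interior bound for very weak solutions** of `∂ₛu = Δ_{h(s)}u − Qu`. Let `h` be a
`C^∞` family of Riemannian metrics on the closed manifold `M` (modelled on `ℝᵐ`), `g₀` a Riemannian
reference metric, `Q` smooth, and `a < a' < b' < b`. There is `C` such that every measurable `u`,
integrable on `M × (a, b)` for `dV_{g₀} ⊗ ds` and satisfying the very weak equation there (the
format of `exists_contMDiffOn_ae_eq_of_linearHeat_veryWeak` with `G = 0`), together with any
representative `v` continuous on `M × (a, b)` and a.e. equal to `u` there, obeys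

  `|v(p)| ≤ C ∫_{M × (a,b)} |u| d(V_{g₀} ⊗ ds)`  for all `p ∈ M × [a', b']`

(hypoellipticity makes `u ↦ v|_{M × [a',b']}` a linear map from the closed subspace of very weak
solutions of `L¹` to `C(M × [a', b'])` with sequentially closed graph; closed graph theorem).
[cite: Hormander1967, Thm. 1.1] -/
theorem exists_const_sup_le_integral_of_linearHeat_veryWeak
    (hh : IsContMDiffFamilyOn ∞ h univ) (hR : ∀ s, (h s).IsRiemannian) (hR₀ : g₀.IsRiemannian)
    {Q : ℝ → M → ℝ} (hQ : ContMDiff (I.prod 𝓘(ℝ, ℝ)) 𝓘(ℝ, ℝ) ∞ fun p : M × ℝ ↦ Q p.2 p.1)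
    {a b a' b' : ℝ} (haa' : a < a') (ha'b' : a' < b') (hb'b : b' < b) :
    ∃ C : ℝ, ∀ u v : M × ℝ → ℝ, Measurable u →
      IntegrableOn u (univ ×ˢ Ioo a b) (g₀.riemVolume.prod (volume : Measure ℝ)) →
      (∀ ζ : M × ℝ → ℝ, ContMDiff (I.prod 𝓘(ℝ, ℝ)) 𝓘(ℝ, ℝ) ∞ ζ → HasCompactSupport ζ →
        tsupport ζ ⊆ univ ×ˢ Ioo a b →
        ∫ p, u p * (-(deriv (fun s ↦ (h s).densityRatio g₀ p.1 * ζ (p.1, s)) p.2) -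
            (h p.2).densityRatio g₀ p.1 * (h p.2).laplaceBeltrami (fun x ↦ ζ (x, p.2)) p.1 +
            (h p.2).densityRatio g₀ p.1 * Q p.2 p.1 * ζ p) ∂g₀.riemVolume.prod (volume : Measure ℝ)
          = 0) →
      ContinuousOn v (univ ×ˢ Ioo a b) →
      (∀ᵐ p ∂g₀.riemVolume.prod (volume : Measure ℝ), p ∈ univ ×ˢ Ioo a b → u p = v p) →
      ∀ p ∈ (univ : Set M) ×ˢ Icc a' b',
        |v p| ≤ C * ∫ p in univ ×ˢ Ioo a b, |u p| ∂g₀.riemVolume.prod (volume : Measure ℝ) := by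
  classical
  have hab : a < b := haa'.trans (ha'b'.trans hb'b)
  -- measures, sets
  set ν : Measure (M × ℝ) := g₀.riemVolume.prod (volume : Measure ℝ) with hν
  set O : Set (M × ℝ) := univ ×ˢ Ioo a b with hO
  have hOo : IsOpen O := isOpen_univ.prod isOpen_Ioo
  have hOm : MeasurableSet O := hOo.measurableSet
  set K : Set (M × ℝ) := univ ×ˢ Icc a' b' with hK
  have hKO : K ⊆ O := prod_mono le_rfl (Icc_subset_Ioo haa' hb'b)
  haveI : CompactSpace K := isCompact_iff_compactSpace.1 (isCompact_univ.prod isCompact_Icc)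
  haveI : IsFiniteMeasure g₀.riemVolume := ⟨g₀.riemVolume_univ_lt_top⟩
  haveI : g₀.riemVolume.IsOpenPosMeasure := riemVolume_eq hR₀ ▸ isOpenPosMeasure_riemannianMeasure _
  haveI : ν.IsOpenPosMeasure := prod.instIsOpenPosMeasure
  set μ : Measure (M × ℝ) := ν.restrict O with hμ
  haveI : IsFiniteMeasure μ := by
    rw [hμ, hν, hO, ← Measure.prod_restrict univ, Measure.restrict_univ]
    infer_instance
  -- the bracket of a test function: continuous and bounded
  set B : (M × ℝ → ℝ) → M × ℝ → ℝ := fun ζ p ↦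
    -(deriv (fun s ↦ (h s).densityRatio g₀ p.1 * ζ (p.1, s)) p.2) -
      (h p.2).densityRatio g₀ p.1 * (h p.2).laplaceBeltrami (fun x ↦ ζ (x, p.2)) p.1 +
      (h p.2).densityRatio g₀ p.1 * Q p.2 p.1 * ζ p with hB
  have hBc : ∀ ζ : M × ℝ → ℝ, ContMDiff (I.prod 𝓘(ℝ, ℝ)) 𝓘(ℝ, ℝ) ∞ ζ → Continuous (B ζ) := by
    intro ζ hζ
    have hρ : ContMDiff (I.prod 𝓘(ℝ, ℝ)) 𝓘(ℝ, ℝ) ∞ fun p : M × ℝ ↦ (h p.2).densityRatio g₀ p.1 := by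
      have := hh.contMDiffOn_densityRatio (g₀ := g₀) (fun s _ ↦ hR s) hR₀
      rwa [univ_prod_univ, contMDiffOn_univ] at this
    have hζ' : ContMDiffOn (I.prod 𝓘(ℝ, ℝ)) 𝓘(ℝ, ℝ) ∞
        (fun p : M × ℝ ↦ (fun s y ↦ ζ (y, s)) p.2 p.1) (univ ×ˢ (univ : Set ℝ)) := by
      simpa using hζ.contMDiffOn
    have h1 := Literature.Geometry.Manifold.contMDiff_deriv_time (I := I)
      (u := fun s y ↦ (h s).densityRatio g₀ y * ζ (y, s)) (hρ.mul hζ)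
    have h2 := hh.contMDiffOn_laplaceBeltrami (f := fun s y ↦ ζ (y, s)) uniqueDiffOn_univ hζ'
    simp only [univ_prod_univ, contMDiffOn_univ] at h2
    exact ((h1.neg.sub (hρ.mul h2)).add ((hρ.mul hQ).mul hζ)).continuous
  have hB0 : ∀ ζ : M × ℝ → ℝ, ∀ p ∉ tsupport ζ, B ζ p = 0 := by
    rintro ζ ⟨y, σ⟩ hp
    obtain ⟨-, hL⟩ := deriv_eq_zero_and_laplaceBeltrami_eq_zero_of_notMem_tsupport (h σ) hp
    have hdρζ : deriv (fun s ↦ (h s).densityRatio g₀ y * ζ (y, s)) σ = 0 := by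
      have e : (fun s ↦ (h s).densityRatio g₀ y * ζ (y, s)) =ᶠ[𝓝 σ] 0 := by
        filter_upwards [eventuallyEq_zero_comp_of_eventuallyEq_zero (ι := fun s ↦ (y, s))
          (Continuous.prodMk_right y) (notMem_tsupport_iff_eventuallyEq.1 hp)] with s hs
        simp [hs]
      rw [e.deriv_eq]; exact deriv_const σ 0
    simp [hB, hL, image_eq_zero_of_notMem_tsupport hp, hdρζ]
  -- `∫ u (B ζ) dν = ∫_O u (B ζ) dν` for `tsupport ζ ⊆ O`
  have hBO : ∀ (ζ : M × ℝ → ℝ) (u : M × ℝ → ℝ), tsupport ζ ⊆ O →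
      ∫ q, u q * B ζ q ∂μ = ∫ q, u q * B ζ q ∂ν := fun ζ u h3 ↦
    setIntegral_eq_integral_of_forall_compl_eq_zero fun q hq ↦ by
      rw [hB0 ζ q (fun h' ↦ hq (h3 h')), mul_zero]
  have hBb : ∀ ζ : M × ℝ → ℝ, ContMDiff (I.prod 𝓘(ℝ, ℝ)) 𝓘(ℝ, ℝ) ∞ ζ → HasCompactSupport ζ →
      ∃ Cζ, ∀ p, ‖B ζ p‖ ≤ Cζ := by
    intro ζ hζ hζc
    obtain ⟨C, hC⟩ := hζc.isCompact.exists_bound_of_continuousOn (hBc ζ hζ).continuousOn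
    refine ⟨max C 0, fun p ↦ ?_⟩
    by_cases hp : p ∈ tsupport ζ
    · exact (hC p hp).trans (le_max_left _ _)
    · rw [hB0 ζ p hp, norm_zero]; exact le_max_right _ _
  -- the space of very weak solutions as a closed subspace of `L¹(μ)`
  set S : Submodule ℝ (Lp ℝ 1 μ) :=
    { carrier := {f | ∀ ζ : M × ℝ → ℝ, ContMDiff (I.prod 𝓘(ℝ, ℝ)) 𝓘(ℝ, ℝ) ∞ ζ →
        HasCompactSupport ζ → tsupport ζ ⊆ O → ∫ p, f p * B ζ p ∂μ = 0}
      zero_mem' := by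
        intro ζ _ _ _
        rw [integral_congr_ae ((Lp.coeFn_zero ℝ 1 μ).mono fun p hp ↦
          show (0 : Lp ℝ 1 μ) p * B ζ p = 0 by rw [hp, Pi.zero_apply, zero_mul])]
        exact integral_zero _ _
      add_mem' := by
        intro f g hf hg ζ h1 h2 h3
        obtain ⟨Cζ, hCζ⟩ := hBb ζ h1 h2
        have hfi : Integrable (fun p ↦ f p * B ζ p) μ :=
          (L1.integrable_coeFn f).mul_bdd (hBc ζ h1).aestronglyMeasurable
            (Eventually.of_forall hCζ)
        have hgi : Integrable (fun p ↦ g p * B ζ p) μ :=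
          (L1.integrable_coeFn g).mul_bdd (hBc ζ h1).aestronglyMeasurable
            (Eventually.of_forall hCζ)
        rw [integral_congr_ae ((Lp.coeFn_add f g).mono fun p hp ↦
          show (f + g) p * B ζ p = f p * B ζ p + g p * B ζ p by rw [hp, Pi.add_apply, add_mul]),
          integral_add hfi hgi, hf ζ h1 h2 h3, hg ζ h1 h2 h3, add_zero]
      smul_mem' := by
        intro c f hf ζ h1 h2 h3
        rw [integral_congr_ae ((Lp.coeFn_smul c f).mono fun p hp ↦
          show (c • f) p * B ζ p = c * (f p * B ζ p) by rw [hp, Pi.smul_apply, smul_eq_mul, mul_assoc]),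
          integral_const_mul, hf ζ h1 h2 h3, mul_zero] } with hS
  have hSmem : ∀ f : Lp ℝ 1 μ, f ∈ S ↔ ∀ ζ : M × ℝ → ℝ, ContMDiff (I.prod 𝓘(ℝ, ℝ)) 𝓘(ℝ, ℝ) ∞ ζ →
      HasCompactSupport ζ → tsupport ζ ⊆ O → ∫ p, f p * B ζ p ∂μ = 0 := fun f ↦ Iff.rfl
  have hSclosed : IsClosed (S : Set (Lp ℝ 1 μ)) := by
    refine IsSeqClosed.isClosed fun f g hf hfg ↦ ?_
    rw [SetLike.mem_coe, hSmem]
    intro ζ h1 h2 h3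
    obtain ⟨Cζ, hCζ⟩ := hBb ζ h1 h2
    -- `∫ g B = lim ∫ f n B = 0`
    have hlim : Tendsto (fun n ↦ ∫ p, f n p * B ζ p ∂μ) atTop (𝓝 (∫ p, g p * B ζ p ∂μ)) := by
      rw [tendsto_iff_norm_sub_tendsto_zero]
      have hbd : ∀ n, ‖∫ p, f n p * B ζ p ∂μ - ∫ p, g p * B ζ p ∂μ‖ ≤ Cζ * ‖f n - g‖ := by
        intro n
        have hi : ∀ f' : Lp ℝ 1 μ, Integrable (fun p ↦ f' p * B ζ p) μ := fun f' ↦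
          (L1.integrable_coeFn f').mul_bdd (hBc ζ h1).aestronglyMeasurable (Eventually.of_forall hCζ)
        rw [← integral_sub (hi (f n)) (hi g), L1.norm_eq_integral_norm,
          ← integral_const_mul]
        have e : (fun p ↦ f n p * B ζ p - g p * B ζ p) =ᵐ[μ] fun p ↦ (f n - g) p * B ζ p := by
          filter_upwards [Lp.coeFn_sub (f n) g] with p hp
          rw [hp, Pi.sub_apply, sub_mul]
        rw [integral_congr_ae e]
        refine (norm_integral_le_integral_norm _).trans (integral_mono_of_nonneg
          (Eventually.of_forall fun _ ↦ norm_nonneg _) ((L1.integrable_coeFn _).norm.const_mul _)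
          (Eventually.of_forall fun p ↦ ?_))
        show ‖_ * _‖ ≤ _
        rw [norm_mul, mul_comm]
        exact mul_le_mul_of_nonneg_right (hCζ p) (norm_nonneg _)
      have h0 : Tendsto (fun n ↦ Cζ * ‖f n - g‖) atTop (𝓝 0) := by
        have := (tendsto_iff_norm_sub_tendsto_zero.1 hfg).const_mul Cζ
        simpa using this
      exact squeeze_zero (fun n ↦ norm_nonneg _) hbd h0
    exact tendsto_nhds_unique hlim (by simp [fun n ↦ (hSmem (f n)).1 (hf n) ζ h1 h2 h3])
  haveI : CompleteSpace S := hSclosed.completeSpace_coe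
  -- the smooth representative of a very weak solution
  have hrep : ∀ f : S, ∃ v : M × ℝ → ℝ, ContinuousOn v O ∧
      ∀ᵐ p ∂ν, p ∈ O → (Lp.aestronglyMeasurable (f : Lp ℝ 1 μ)).mk (f : Lp ℝ 1 μ) p = v p := by
    intro f
    set u := (Lp.aestronglyMeasurable (f : Lp ℝ 1 μ)).mk (f : Lp ℝ 1 μ) with hu
    have hum : Measurable u := (Lp.aestronglyMeasurable (f : Lp ℝ 1 μ)).stronglyMeasurable_mk.measurable
    have huf : (f : Lp ℝ 1 μ) =ᵐ[μ] u := (Lp.aestronglyMeasurable (f : Lp ℝ 1 μ)).ae_eq_mk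
    have hui : IntegrableOn u O ν := (L1.integrable_coeFn (f : Lp ℝ 1 μ)).congr huf
    have hweak : ∀ ζ : M × ℝ → ℝ, ContMDiff (I.prod 𝓘(ℝ, ℝ)) 𝓘(ℝ, ℝ) ∞ ζ → HasCompactSupport ζ →
        tsupport ζ ⊆ O →
        ∫ p, u p * (-(deriv (fun s ↦ (h s).densityRatio g₀ p.1 * ζ (p.1, s)) p.2) -
            (h p.2).densityRatio g₀ p.1 * (h p.2).laplaceBeltrami (fun x ↦ ζ (x, p.2)) p.1 +
            (h p.2).densityRatio g₀ p.1 * Q p.2 p.1 * ζ p) ∂ν =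
          ∫ p, (h p.2).densityRatio g₀ p.1 * (fun (_ : ℝ) (_ : M) ↦ (0 : ℝ)) p.2 p.1 * ζ p ∂ν := by
      intro ζ h1 h2 h3
      show ∫ p, u p * B ζ p ∂ν = _
      simp only [mul_zero, zero_mul, integral_zero]
      rw [← hBO ζ u h3, integral_congr_ae (huf.mono fun p hp ↦
        show u p * B ζ p = (f : Lp ℝ 1 μ) p * B ζ p by rw [← hp])]
      exact (hSmem _).1 f.2 ζ h1 h2 h3
    obtain ⟨v, hv, hae⟩ := exists_contMDiffOn_ae_eq_of_linearHeat_veryWeak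
      (G := fun (_ : ℝ) (_ : M) ↦ (0 : ℝ)) hh hR hR₀ hQ contMDiff_const (isOpen_Ioo (a := a) (b := b))
      hum hui.locallyIntegrableOn hweak
    exact ⟨v, hv.continuousOn, hae⟩
  choose rep hrepc hrepae using hrep
  -- representatives are unique, hence linear in `f`
  have hunique : ∀ (f : S) (w : M × ℝ → ℝ), ContinuousOn w O →
      (∀ᵐ p ∂ν, p ∈ O → (f : Lp ℝ 1 μ) p = w p) → EqOn (rep f) w O := by
    intro f w hw hfw
    refine eqOn_of_ae_eq_of_continuousOn (μ := ν) hOo (hrepc f) hw ?_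
    have huf : ∀ᵐ p ∂ν, p ∈ O → (Lp.aestronglyMeasurable (f : Lp ℝ 1 μ)).mk (f : Lp ℝ 1 μ) p =
        (f : Lp ℝ 1 μ) p := by
      have := (ae_restrict_iff' (μ := ν) hOm).1 (Lp.aestronglyMeasurable (f : Lp ℝ 1 μ)).ae_eq_mk
      exact this.mono fun p hp hpO ↦ (hp hpO).symm
    filter_upwards [hrepae f, huf, hfw] with p h1 h2 h3 hpO
    rw [← h1 hpO, h2 hpO, h3 hpO]
  have hfae : ∀ f : S, ∀ᵐ p ∂ν, p ∈ O → (f : Lp ℝ 1 μ) p = rep f p := by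
    intro f
    have := (ae_restrict_iff' (μ := ν) hOm).1 (Lp.aestronglyMeasurable (f : Lp ℝ 1 μ)).ae_eq_mk
    filter_upwards [this, hrepae f] with p h1 h2 hpO
    rw [h1 hpO, h2 hpO]
  -- the linear map `T f = rep f |_K`
  have hTc : ∀ f : S, Continuous fun q : K ↦ rep f q := fun f ↦
    (hrepc f).comp_continuous continuous_subtype_val fun q ↦ hKO q.2
  set T : S →ₗ[ℝ] C(K, ℝ) :=
    { toFun := fun f ↦ ⟨fun q ↦ rep f q, hTc f⟩
      map_add' := fun f g ↦ by
        ext q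
        show rep (f + g) q = rep f q + rep g q
        have key := hunique (f + g) (fun p ↦ rep f p + rep g p) ((hrepc f).add (hrepc g)) (by
          filter_upwards [hfae f, hfae g, (ae_restrict_iff' hOm (μ := ν)).1
            (Lp.coeFn_add (f : Lp ℝ 1 μ) (g : Lp ℝ 1 μ))] with p h1 h2 h3 hpO
          rw [Submodule.coe_add, h3 hpO, Pi.add_apply, h1 hpO, h2 hpO])
        exact key (hKO q.2)
      map_smul' := fun c f ↦ by
        ext q
        show rep (c • f) q = c * rep f q
        have key := hunique (c • f) (fun p ↦ c * rep f p) (continuousOn_const.mul (hrepc f)) (by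
          filter_upwards [hfae f, (ae_restrict_iff' hOm (μ := ν)).1
            (Lp.coeFn_smul c (f : Lp ℝ 1 μ))] with p h1 h3 hpO
          rw [Submodule.coe_smul, h3 hpO, Pi.smul_apply, smul_eq_mul, h1 hpO])
        exact key (hKO q.2) } with hT
  have hTapp : ∀ (f : S) (q : K), T f q = rep f q := fun f q ↦ rfl
  -- the graph of `T` is sequentially closed
  have hTcont : Continuous T := by
    refine T.continuous_of_seq_closed_graph fun f g w hfg hTw ↦ ?_
    have hLp : Tendsto (fun n ↦ (f n : Lp ℝ 1 μ)) atTop (𝓝 (g : Lp ℝ 1 μ)) :=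
      (continuous_subtype_val.tendsto _).comp hfg
    obtain ⟨ns, hns, hae⟩ := (tendstoInMeasure_of_tendsto_Lp hLp).exists_seq_tendsto_ae
    have hpt : ∀ q : K, Tendsto (fun i ↦ T (f (ns i)) q) atTop (𝓝 (w q)) := fun q ↦
      ((continuous_eval_const q).tendsto w).comp (hTw.comp hns.tendsto_atTop)
    -- hence `w = rep g` a.e. on `K`
    have haeK : ∀ᵐ p ∂ν, ∀ hp : p ∈ K, w ⟨p, hp⟩ = rep g p := by
      have hae' : ∀ᵐ p ∂ν, p ∈ O → Tendsto (fun i ↦ (f (ns i) : Lp ℝ 1 μ) p) atTop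
          (𝓝 ((g : Lp ℝ 1 μ) p)) := (ae_restrict_iff' (μ := ν) hOm).1 hae
      have hall : ∀ᵐ p ∂ν, ∀ i, p ∈ O → (f (ns i) : Lp ℝ 1 μ) p = rep (f (ns i)) p :=
        ae_all_iff.2 fun i ↦ hfae (f (ns i))
      filter_upwards [hae', hall, hfae g] with p h1 h2 h3 hpK
      have hpO := hKO hpK
      have e : (fun i ↦ T (f (ns i)) ⟨p, hpK⟩) = fun i ↦ (f (ns i) : Lp ℝ 1 μ) p := by
        funext i; rw [hTapp, h2 i hpO]
      have := hpt ⟨p, hpK⟩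
      rw [e] at this
      exact h3 hpO ▸ tendsto_nhds_unique this (h1 hpO)
    -- two continuous functions on `K` agreeing a.e.: equal on the relative interior, hence on `K`
    ext q
    rw [hTapp]
    by_contra hne
    -- `{w ≠ rep g}` is relatively open in `K`: `= U' ∩ K` with `U'` open
    have hwc : Continuous fun q : K ↦ w q - rep g q := w.continuous.sub (hTc g)
    obtain ⟨U', hU'o, hU'⟩ : ∃ U' : Set (M × ℝ), IsOpen U' ∧
        Subtype.val ⁻¹' U' = {q : K | w q - rep g q ≠ 0} :=
      ⟨_, (isOpen_induced_iff.1 (isOpen_ne.preimage hwc)).choose_spec.1,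
        (isOpen_induced_iff.1 (isOpen_ne.preimage hwc)).choose_spec.2⟩
    have hqU' : q ∈ Subtype.val ⁻¹' U' := by rw [hU']; exact sub_ne_zero.2 hne
    obtain ⟨q', hq'U', hq'O'⟩ := exists_mem_Ioo_of_relOpen ha'b' hU'o hqU' q.2
    -- the open set `U' ∩ (M × (a', b'))` has positive measure but `w = rep g` a.e. there
    refine ((hU'o.inter (isOpen_univ.prod isOpen_Ioo)).measure_pos ν ⟨q', hq'U', hq'O'⟩).ne' ?_
    show ν (U' ∩ univ ×ˢ Ioo a' b') = 0
    rw [measure_eq_zero_iff_ae_notMem]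
    filter_upwards [haeK] with p hp ⟨hpU', hpO'⟩
    have hpK : p ∈ K := ⟨mem_univ _, Ioo_subset_Icc_self hpO'.2⟩
    have h1 : (⟨p, hpK⟩ : K) ∈ Subtype.val ⁻¹' U' := hpU'
    rw [hU'] at h1
    exact h1 (sub_eq_zero.2 (hp hpK))
  -- the bound
  set Tc : S →L[ℝ] C(K, ℝ) := ⟨T, hTcont⟩ with hTcdef
  refine ⟨‖Tc‖, fun u v hum hui hweak hv huv p hp ↦ ?_⟩
  -- `u` as an element of `S`
  have hui' : Integrable u μ := hui
  set f : Lp ℝ 1 μ := hui'.toL1 u with hf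
  have hfu : f =ᵐ[μ] u := hui'.coeFn_toL1
  have hfS : f ∈ S := by
    rw [hSmem]
    intro ζ h1 h2 h3
    rw [integral_congr_ae (hfu.mono fun q hq ↦ show f q * B ζ q = u q * B ζ q by rw [hq]),
      hBO ζ u h3]
    exact hweak ζ h1 h2 h3
  set fS : S := ⟨f, hfS⟩
  -- `rep fS = v` on `O`
  have hrv : EqOn (rep fS) v O := hunique fS v hv (by
    have h1 : ∀ᵐ q ∂ν, q ∈ O → f q = u q := (ae_restrict_iff' (μ := ν) hOm).1 hfu
    filter_upwards [h1, huv] with q h1 h2 hqO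
    rw [show ((fS : S) : Lp ℝ 1 μ) = f from rfl, h1 hqO, h2 hqO])
  -- `|v p| = |T fS ⟨p, hp⟩| ≤ ‖T fS‖ ≤ ‖Tc‖ ‖fS‖ = ‖Tc‖ ∫ |u|`
  have h1 : |v p| ≤ ‖Tc fS‖ := by
    rw [← hrv (hKO hp), ← Real.norm_eq_abs]
    exact (Tc fS).norm_coe_le_norm ⟨p, hp⟩
  have h2 : ‖Tc fS‖ ≤ ‖Tc‖ * ‖fS‖ := Tc.le_opNorm fS
  have h3 : ‖fS‖ = ∫ q in O, |u q| ∂ν := by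
    rw [show ‖fS‖ = ‖f‖ from rfl, L1.norm_eq_integral_norm]
    exact integral_congr_ae (hfu.mono fun q hq ↦ by
      show ‖f q‖ = |u q|
      rw [hq, Real.norm_eq_abs])
  calc |v p| ≤ ‖Tc‖ * ‖fS‖ := h1.trans h2
    _ = ‖Tc‖ * ∫ q in O, |u q| ∂ν := by rw [h3]

end UniformBound

end Literature.Geometry.Riemannian
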